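import Summits.Schanuel.Schanuel.Theorems.RootDecomp1KHyper04
import Summits.Schanuel.Schanuel.Theorems.RootDecomp1EEStableRung

/-!
# RootDecomp1EScaleTransfer — lens 2, generation 35 «SCALE-TRANSFER CELL» (ScaleTransfer.lean bf37e395…, 1670 l) — part 1 (RootDecomp1EScaleTransfer01): §1 exponential polynomials in the scale `expPoly`; §2 exponent substitution `msize` / `edeg` / `emap` / `subst`, `columns_free`

PORT NOTE (census-1 gen 15, 2026-08-31): port of HOME/decomp-schanuel-lens-2/g35/ScaleTransfer.lean (sha256 bf37e395…8f98, 1670 l; own farm rc 0 · 0 warn ·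
0 sorry · axioms std; critic VERDICT STATUS L1636: checklist (1)–(4) MET, ONE cell-decision credit on 1E to lens-2; (d) PORT GO LOW census lane)
in FIVE parts `RootDecomp1EScaleTransfer01`–`05` by the cut plan of NODE-g35 §5: 01 = §1–§2 (exponential polynomials in the scale, exponent
substitution), 02 = §3 (the cut `HyperScaleApprox` + TRANSFER KERNEL `algebraicIndependent_exp_scale`, `maxHeartbeats 1600000` as in the source),
03 = §4 cells (`schanuel_on_scaleClass`, `eStableDefectOne_scaleCell`, …) + §5a the `ℤ[√2]`-tower scale `ξ_Q`, 04 = §5b–§5c (members `z_Q⁽⁴⁾`, `z_Q⁽³⁾`,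
hypothesis-free certificates, the LIVE items 31409 / 31410 / 25020 APPLIED), 05 = §5d (robustness of the line `ξ_Q · ℚ(√2, i)`). §6 (critic probes:
F0 `Iff.rfl` / F1 `example`s) and §7 (`#guard_msgs` axiom closures) are NOT ported (verification scaffolding; they stay in the HOME file and in the
critic's probe STprobe.lean 26245160…). The two `set_option linter.*` lines dropped; the explicit `import …Theses.RootDecomp1E` dropped (the module is
already in the cone of `RootDecomp1EEStableRung`, so the `_applied` live links elaborate unchanged); 71 one-line docstrings added; six generic
one-liners (`self_le_exp`, `sqrt_two_lt_three_halves`, `one_lt_sqrt_two'`, `isAlgebraic_I'`, `sqrt_two_mul_self`, `rat_mul_eq_int_of_den_dvd`) made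
`private` (per-part private copies); statements and proofs verbatim; `hLW : LWMeasure` stays a binder BY NAME. `--supports stmt-Schanuel-31409`
(cells for 31410 / 25020 ride along); no census credit. Nothing here proves Schanuel; rung 0. The lens's header follows.
-/

/-!
# RootDecomp1E — lens 2, gen 35 «SCALE TRANSFER»: the Diophantine type OF THE SCALE of a
# projectively-algebraic tuple (draft node file; see NODE-g35.md)
-/

noncomputable section

open Complex IntermediateField
open Summit.Schanuel.Schanuel.Theorems.RootDecomp1KHyper (LWMeasure SB SFset mvlen mvlen_nonneg
  abs_coeff_le_mvlen one_le_mvlen exists_int_mul_eq_map mvaeval_int_map sb_of_algebraicIndependent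
  mem_adjoin_SFset_I' form_ne_zero_of_linearIndependent)

namespace Summit.Schanuel.Schanuel.Theorems.RootDecomp1EScaleTransfer

/-! ## §1 Exponential polynomials in the scale: `t ↦ P(e^{t y₁}, …, e^{t yₙ})` -/

/-- The exponential polynomial `t ↦ P(e^{t y₁}, …, e^{t yₙ})` of an integer polynomial `P`. -/
def expPoly {n : ℕ} (y : Fin n → ℂ) (P : MvPolynomial (Fin n) ℤ) (t : ℂ) : ℂ :=
  MvPolynomial.aeval (fun j => cexp (t * y j)) P

/-- A monomial in the `e^{t y_j}` is one exponential `e^{t Σ a_j y_j}`. -/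
theorem prod_exp_pow_eq {n : ℕ} (y : Fin n → ℂ) (t : ℂ) (a : Fin n →₀ ℕ) :
    (a.prod fun j k => cexp (t * y j) ^ k) = cexp (t * ∑ j, (a j : ℂ) * y j) := by
  rw [Finsupp.prod_pow, Finset.mul_sum, Complex.exp_sum]
  refine Finset.prod_congr rfl fun j _ => ?_
  rw [← Complex.exp_nat_mul]
  congr 1; ring

/-- `P(e^{t y}) = Σ_a coeff_a(P) · e^{t Σ_j a_j y_j}`. -/
theorem expPoly_eq_sum {n : ℕ} (y : Fin n → ℂ) (P : MvPolynomial (Fin n) ℤ) (t : ℂ) :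
    expPoly y P t = ∑ a ∈ P.support, ((P.coeff a : ℤ) : ℂ) * cexp (t * ∑ j, (a j : ℂ) * y j) := by
  unfold expPoly
  rw [MvPolynomial.aeval_def, MvPolynomial.eval₂_eq]
  refine Finset.sum_congr rfl fun a _ => ?_
  rw [← prod_exp_pow_eq y t a, Finsupp.prod_pow, ← Finsupp.prod_pow a fun j => cexp (t * y j)]
  simp [Finsupp.prod]

/-- `t ↦ P(e^{t y})` is complex-differentiable. -/
theorem differentiable_expPoly {n : ℕ} (y : Fin n → ℂ) (P : MvPolynomial (Fin n) ℤ) :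
    Differentiable ℂ (expPoly y P) := by
  have h : expPoly y P =
      fun t => ∑ a ∈ P.support, ((P.coeff a : ℤ) : ℂ) * cexp (t * ∑ j, (a j : ℂ) * y j) :=
    funext (expPoly_eq_sum y P)
  rw [h]
  fun_prop

/-- **Lipschitz bound at a zero of the exponential polynomial**: if `P(e^{ξ y}) = 0` then
`‖P(e^{t y})‖ ≤ K ‖t − ξ‖` on a ball about `ξ` (`K ≥ 1`). -/
theorem exists_lipschitz_expPoly {n : ℕ} (y : Fin n → ℂ) (P : MvPolynomial (Fin n) ℤ) (ξ : ℂ)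
    (hξ : expPoly y P ξ = 0) :
    ∃ K δ : ℝ, 1 ≤ K ∧ 0 < δ ∧ ∀ t : ℂ, ‖t - ξ‖ < δ → ‖expPoly y P t‖ ≤ K * ‖t - ξ‖ := by
  have hcd : ContDiffAt ℂ 1 (expPoly y P) ξ :=
    ((differentiable_expPoly y P).contDiff (n := 1)).contDiffAt
  obtain ⟨K, s, hs, hK⟩ := hcd.exists_lipschitzOnWith
  obtain ⟨δ, hδ, hball⟩ := Metric.mem_nhds_iff.mp hs
  refine ⟨(K : ℝ) + 1, δ, by simp, hδ, fun t ht => ?_⟩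
  have hts : t ∈ s := hball (by rw [Metric.mem_ball, dist_eq_norm]; exact ht)
  have hξs : ξ ∈ s := mem_of_mem_nhds hs
  have h1 := hK.dist_le_mul t hts ξ hξs
  rw [hξ, dist_zero_right, dist_eq_norm] at h1
  calc ‖expPoly y P t‖ ≤ K * ‖t - ξ‖ := h1
    _ ≤ (K + 1) * ‖t - ξ‖ := by gcongr; simp

/-! ## §2 Exponent substitution: a monomial change `X_j ↦ ∏_i E_i^{M_ij}` shifted by `(∏_i E_i)^N` -/

variable {D n : ℕ}

/-- Size `Σ_{i,j} |M_ij|` of an integer matrix. -/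
def msize (M : Fin D → Fin n → ℤ) : ℕ := ∑ i, ∑ j, (M i j).natAbs

/-- Every entry `|M i j|` is bounded by `msize M`. -/
theorem natAbs_le_msize (M : Fin D → Fin n → ℤ) (i : Fin D) (j : Fin n) :
    (M i j).natAbs ≤ msize M := by
  unfold msize
  calc (M i j).natAbs ≤ ∑ j', (M i j').natAbs :=
        Finset.single_le_sum (f := fun j' => (M i j').natAbs) (fun _ _ => Nat.zero_le _)
          (Finset.mem_univ j)
    _ ≤ ∑ i', ∑ j', (M i' j').natAbs :=
        Finset.single_le_sum (f := fun i' => ∑ j', (M i' j').natAbs) (fun _ _ => Nat.zero_le _)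
          (Finset.mem_univ i)

/-- The degree `|a| = Σ_j a_j` of an exponent vector. -/
def edeg (a : Fin n →₀ ℕ) : ℕ := ∑ j, a j

/-- The degree `edeg a = Σ_j a j` as a `Finsupp.sum`. -/
theorem edeg_eq_sum (a : Fin n →₀ ℕ) : (a.sum fun _ e => e) = edeg a := by
  unfold edeg
  exact Finsupp.sum_fintype _ _ fun _ => rfl

/-- `|Σ_j M_ij a_j| ≤ msize(M) · |a|`. -/
theorem abs_rowsum_le (M : Fin D → Fin n → ℤ) (i : Fin D) (a : Fin n →₀ ℕ) :
    |∑ j, M i j * (a j : ℤ)| ≤ (msize M : ℤ) * (edeg a : ℤ) := by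
  calc |∑ j, M i j * (a j : ℤ)| ≤ ∑ j, |M i j * (a j : ℤ)| := Finset.abs_sum_le_sum_abs _ _
    _ = ∑ j, |M i j| * (a j : ℤ) := by
        refine Finset.sum_congr rfl fun j _ => ?_
        rw [abs_mul, abs_of_nonneg (by positivity : (0 : ℤ) ≤ (a j : ℤ))]
    _ ≤ ∑ j, (msize M : ℤ) * (a j : ℤ) := by
        refine Finset.sum_le_sum fun j _ => ?_
        gcongr
        rw [Int.abs_eq_natAbs]
        exact_mod_cast natAbs_le_msize M i j
    _ = (msize M : ℤ) * (edeg a : ℤ) := by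
        rw [← Finset.mul_sum]; unfold edeg; push_cast; rfl

/-- The shifted exponent map `e(a)_i = N + Σ_j M_ij a_j` (as a natural number; meaningful when
`|a| ≤ d` and `N = msize(M) · d`). -/
def emap (M : Fin D → Fin n → ℤ) (N : ℕ) (a : Fin n →₀ ℕ) : Fin D →₀ ℕ :=
  Finsupp.equivFunOnFinite.symm fun i => ((N : ℤ) + ∑ j, M i j * (a j : ℤ)).toNat

/-- Coordinates of the shifted exponent map: `emap M N a i = (N + Σ_j M i j · a j).toNat`. -/
theorem emap_apply (M : Fin D → Fin n → ℤ) (N : ℕ) (a : Fin n →₀ ℕ) (i : Fin D) :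
    emap M N a i = ((N : ℤ) + ∑ j, M i j * (a j : ℤ)).toNat := rfl

/-- The shifted exponent `msize M · d + Σ_j M i j · a j` is non-negative when `edeg a ≤ d`. -/
theorem emap_arg_nonneg (M : Fin D → Fin n → ℤ) {d : ℕ} {a : Fin n →₀ ℕ} (ha : edeg a ≤ d)
    (i : Fin D) : 0 ≤ ((msize M * d : ℕ) : ℤ) + ∑ j, M i j * (a j : ℤ) := by
  have h1 := abs_rowsum_le M i a
  have h2 : (msize M : ℤ) * (edeg a : ℤ) ≤ (msize M : ℤ) * (d : ℤ) := by
    gcongr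
  have h3 := neg_abs_le (∑ j, M i j * (a j : ℤ))
  push_cast
  linarith

/-- The shifted exponent is at most `2 · msize M · d` when `edeg a ≤ d`. -/
theorem emap_arg_le (M : Fin D → Fin n → ℤ) {d : ℕ} {a : Fin n →₀ ℕ} (ha : edeg a ≤ d)
    (i : Fin D) : ((msize M * d : ℕ) : ℤ) + ∑ j, M i j * (a j : ℤ) ≤ 2 * ((msize M * d : ℕ) : ℤ) := by
  have h1 := abs_rowsum_le M i a
  have h2 : (msize M : ℤ) * (edeg a : ℤ) ≤ (msize M : ℤ) * (d : ℤ) := by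
    gcongr
  have h3 := le_abs_self (∑ j, M i j * (a j : ℤ))
  push_cast
  linarith

/-- On `|a| ≤ d`, with `N = msize(M)·d`: `(e(a)_i : ℤ) = N + Σ_j M_ij a_j`. -/
theorem emap_cast (M : Fin D → Fin n → ℤ) {d : ℕ} {a : Fin n →₀ ℕ} (ha : edeg a ≤ d) (i : Fin D) :
    ((emap M (msize M * d) a i : ℕ) : ℤ) = ((msize M * d : ℕ) : ℤ) + ∑ j, M i j * (a j : ℤ) := by
  rw [emap_apply, Int.toNat_of_nonneg (emap_arg_nonneg M ha i)]

/-- `emap M (msize M · d) a i ≤ 2 · msize M · d` when `edeg a ≤ d`. -/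
theorem emap_le (M : Fin D → Fin n → ℤ) {d : ℕ} {a : Fin n →₀ ℕ} (ha : edeg a ≤ d) (i : Fin D) :
    emap M (msize M * d) a i ≤ 2 * (msize M * d) := by
  have h := emap_arg_le M ha i
  have hc := emap_cast M ha i
  have : ((emap M (msize M * d) a i : ℕ) : ℤ) ≤ ((2 * (msize M * d) : ℕ) : ℤ) := by
    rw [hc]; push_cast at h ⊢; linarith
  exact_mod_cast this

/-- The degree of `e(a)` is at most `2 D N`. -/
theorem edeg_emap_le (M : Fin D → Fin n → ℤ) {d : ℕ} {a : Fin n →₀ ℕ} (ha : edeg a ≤ d) :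
    edeg (emap M (msize M * d) a) ≤ D * (2 * (msize M * d)) := by
  unfold edeg
  calc ∑ i, emap M (msize M * d) a i ≤ ∑ _i : Fin D, 2 * (msize M * d) :=
        Finset.sum_le_sum fun i _ => emap_le M ha i
    _ = D * (2 * (msize M * d)) := by simp

/-- **Column-freeness ⇒ injectivity of the exponent map on the box `|a| ≤ d`.** -/
theorem emap_injOn (M : Fin D → Fin n → ℤ)
    (hM : ∀ v : Fin n → ℤ, (∀ i, ∑ j, M i j * v j = 0) → v = 0) (d : ℕ) :
    Set.InjOn (emap M (msize M * d)) {a | edeg a ≤ d} := by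
  intro a ha a' ha' h
  have hrow : ∀ i, ∑ j, M i j * ((a j : ℤ) - (a' j : ℤ)) = 0 := by
    intro i
    have h1 : ((emap M (msize M * d) a i : ℕ) : ℤ) = ((emap M (msize M * d) a' i : ℕ) : ℤ) := by
      rw [h]
    rw [emap_cast M ha i, emap_cast M ha' i] at h1
    have h2 : ∑ j, M i j * (a j : ℤ) = ∑ j, M i j * (a' j : ℤ) := by linarith
    rw [← sub_eq_zero, ← Finset.sum_sub_distrib] at h2
    rw [← h2]
    exact Finset.sum_congr rfl fun j _ => by ring
  have hv := hM (fun j => (a j : ℤ) - (a' j : ℤ)) hrow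
  ext j
  have := congrFun hv j
  simp only [Pi.zero_apply, sub_eq_zero] at this
  exact_mod_cast this

/-- From `γ y_j = Σ_i M_ij ω_i`, `γ ≠ 0`, `y` ℚ-free: the columns of `M` are free. -/
theorem columns_free {ω : Fin D → ℂ} {y : Fin n → ℂ} (hy : LinearIndependent ℚ y) {γ : ℂ}
    (hγ : γ ≠ 0) {M : Fin D → Fin n → ℤ} (hM : ∀ j, γ * y j = ∑ i, (M i j : ℂ) * ω i) :
    ∀ v : Fin n → ℤ, (∀ i, ∑ j, M i j * v j = 0) → v = 0 := by
  intro v hv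
  by_contra hv0
  have hne := form_ne_zero_of_linearIndependent hy hv0
  apply hne
  have h1 : γ * ∑ j, (v j : ℂ) * y j = ∑ i, ((∑ j, M i j * v j : ℤ) : ℂ) * ω i := by
    rw [Finset.mul_sum]
    have e1 : ∀ j, γ * ((v j : ℂ) * y j) = (v j : ℂ) * ∑ i, (M i j : ℂ) * ω i := by
      intro j; rw [← hM j]; ring
    simp_rw [e1, Finset.mul_sum]
    rw [Finset.sum_comm]
    refine Finset.sum_congr rfl fun i _ => ?_
    push_cast
    rw [Finset.sum_mul]
    exact Finset.sum_congr rfl fun j _ => by ring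
  have h2 : ∑ i, ((∑ j, M i j * v j : ℤ) : ℂ) * ω i = 0 := by
    refine Finset.sum_eq_zero fun i _ => ?_
    rw [hv i]; simp
  rw [h2] at h1
  exact (mul_eq_zero.mp h1).resolve_left hγ

/-- The substituted polynomial `A = Σ_a coeff_a(P) · X^{e(a)}`. -/
def subst (M : Fin D → Fin n → ℤ) (P : MvPolynomial (Fin n) ℤ) : MvPolynomial (Fin D) ℤ :=
  ∑ a ∈ P.support, MvPolynomial.monomial (emap M (msize M * P.totalDegree) a) (P.coeff a)

/-- A monomial of `P` has `edeg ≤ P.totalDegree`. -/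
theorem edeg_le_totalDegree {P : MvPolynomial (Fin n) ℤ} {a : Fin n →₀ ℕ} (ha : a ∈ P.support) :
    edeg a ≤ P.totalDegree := by
  rw [← edeg_eq_sum]; exact MvPolynomial.le_totalDegree ha

/-- For an injective exponent lattice `M`, the coefficient of `subst M P` at `emap M _ a` is the coefficient of `P` at `a`. -/
theorem coeff_subst_emap (M : Fin D → Fin n → ℤ)
    (hM : ∀ v : Fin n → ℤ, (∀ i, ∑ j, M i j * v j = 0) → v = 0)
    (P : MvPolynomial (Fin n) ℤ) {a : Fin n →₀ ℕ} (ha : a ∈ P.support) :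
    (subst M P).coeff (emap M (msize M * P.totalDegree) a) = P.coeff a := by
  classical
  unfold subst
  rw [MvPolynomial.coeff_sum]
  simp only [MvPolynomial.coeff_monomial]
  rw [Finset.sum_eq_single a]
  · simp
  · intro b hb hba
    rw [if_neg]
    intro h
    exact hba (emap_injOn M hM P.totalDegree (edeg_le_totalDegree hb) (edeg_le_totalDegree ha) h)
  · intro h; exact absurd ha h

/-- Coefficients of `subst M P` vanish off the image of the monomials of `P` under `emap`. -/
theorem coeff_subst_of_not_mem (M : Fin D → Fin n → ℤ) (P : MvPolynomial (Fin n) ℤ)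
    {b : Fin D →₀ ℕ} (hb : ∀ a ∈ P.support, emap M (msize M * P.totalDegree) a ≠ b) :
    (subst M P).coeff b = 0 := by
  classical
  unfold subst
  rw [MvPolynomial.coeff_sum]
  refine Finset.sum_eq_zero fun a ha => ?_
  simp only [MvPolynomial.coeff_monomial]
  rw [if_neg (hb a ha)]

/-- The substituted polynomial has the same naive height. -/
theorem abs_coeff_subst_le (M : Fin D → Fin n → ℤ)
    (hM : ∀ v : Fin n → ℤ, (∀ i, ∑ j, M i j * v j = 0) → v = 0)
    (P : MvPolynomial (Fin n) ℤ) {H : ℤ} (hH : ∀ a, |P.coeff a| ≤ H) (b : Fin D →₀ ℕ) :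
    |(subst M P).coeff b| ≤ H := by
  classical
  by_cases h : ∃ a ∈ P.support, emap M (msize M * P.totalDegree) a = b
  · obtain ⟨a, ha, rfl⟩ := h
    rw [coeff_subst_emap M hM P ha]; exact hH a
  · push Not at h
    rw [coeff_subst_of_not_mem M P h, abs_zero]
    exact (abs_nonneg _).trans (hH 0)

/-- The substituted polynomial of a non-zero polynomial is non-zero. -/
theorem subst_ne_zero (M : Fin D → Fin n → ℤ)
    (hM : ∀ v : Fin n → ℤ, (∀ i, ∑ j, M i j * v j = 0) → v = 0)
    {P : MvPolynomial (Fin n) ℤ} (hP : P ≠ 0) : subst M P ≠ 0 := by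
  obtain ⟨a, ha⟩ := MvPolynomial.support_nonempty.mpr hP
  intro h0
  have h1 := coeff_subst_emap M hM P ha
  rw [h0, MvPolynomial.coeff_zero] at h1
  exact (MvPolynomial.mem_support_iff.mp ha) h1.symm

/-- The substituted polynomial has total degree `≤ 2 D N`, `N = msize(M) · deg P`. -/
theorem totalDegree_subst_le (M : Fin D → Fin n → ℤ) (P : MvPolynomial (Fin n) ℤ) :
    (subst M P).totalDegree ≤ D * (2 * (msize M * P.totalDegree)) := by
  unfold subst
  refine (MvPolynomial.totalDegree_finsetSum _ _).trans (Finset.sup_le fun a ha => ?_)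
  refine (MvPolynomial.totalDegree_monomial_le _ _).trans ?_
  have e : ((emap M (msize M * P.totalDegree) a).sum fun _ ↦ id) =
      edeg (emap M (msize M * P.totalDegree) a) := by
    unfold edeg; exact Finsupp.sum_fintype _ _ fun _ => rfl
  rw [e]
  exact edeg_emap_le M (edeg_le_totalDegree ha)

/-- **The evaluation identity.** With `E_i = e^{ω_i}` and `γ y_j = Σ_i M_ij ω_i`:
`A(E) = e^{N Σ_i ω_i} · P(e^{γ y})`. -/
theorem aeval_subst (M : Fin D → Fin n → ℤ) (P : MvPolynomial (Fin n) ℤ) {ω : Fin D → ℂ} {y : Fin n → ℂ} {γ : ℂ}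
    (hγ : ∀ j, γ * y j = ∑ i, (M i j : ℂ) * ω i) :
    MvPolynomial.aeval (fun i => cexp (ω i)) (subst M P) =
      cexp (((msize M * P.totalDegree : ℕ) : ℂ) * ∑ i, ω i) * expPoly y P γ := by
  classical
  set N : ℕ := msize M * P.totalDegree with hN
  -- left-hand side, monomial by monomial
  have hmono : ∀ a ∈ P.support,
      ((emap M N a).prod fun i k => cexp (ω i) ^ k) =
        cexp ((N : ℂ) * ∑ i, ω i) * cexp (γ * ∑ j, (a j : ℂ) * y j) := by
    intro a ha
    have hdeg := edeg_le_totalDegree ha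
    have e1 : ∀ i, cexp (ω i) ^ (emap M N a i) = cexp (((emap M N a i : ℕ) : ℂ) * ω i) := by
      intro i; rw [← Complex.exp_nat_mul]
    have e2 : ∀ i, ((emap M N a i : ℕ) : ℂ) = (N : ℂ) + ∑ j, (M i j : ℂ) * (a j : ℂ) := by
      intro i
      have h := emap_cast M hdeg i
      rw [← hN] at h
      have h' : (((emap M N a i : ℕ) : ℤ) : ℂ) = (((N : ℕ) : ℤ) + ∑ j, M i j * (a j : ℤ) : ℤ) := by
        rw [h]
      push_cast at h'
      rw [h']
    have e3 : ∀ j, γ * ((a j : ℂ) * y j) = (a j : ℂ) * ∑ i, (M i j : ℂ) * ω i := by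
      intro j; rw [← hγ j]; ring
    -- Σ_i e(a)_i ω_i = N Σ_i ω_i + γ Σ_j a_j y_j
    have key : ∑ i, ((emap M N a i : ℕ) : ℂ) * ω i = (N : ℂ) * ∑ i, ω i + γ * ∑ j, (a j : ℂ) * y j := by
      calc ∑ i, ((emap M N a i : ℕ) : ℂ) * ω i
          = ∑ i, ((N : ℂ) * ω i + (∑ j, (M i j : ℂ) * (a j : ℂ)) * ω i) :=
            Finset.sum_congr rfl fun i _ => by rw [e2 i, add_mul]
        _ = (N : ℂ) * ∑ i, ω i + ∑ i, (∑ j, (M i j : ℂ) * (a j : ℂ)) * ω i := by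
            rw [Finset.sum_add_distrib, Finset.mul_sum]
        _ = (N : ℂ) * ∑ i, ω i + ∑ j, (a j : ℂ) * ∑ i, (M i j : ℂ) * ω i := by
            congr 1
            simp_rw [Finset.sum_mul, Finset.mul_sum]
            rw [Finset.sum_comm]
            exact Finset.sum_congr rfl fun i _ => Finset.sum_congr rfl fun j _ => by ring
        _ = (N : ℂ) * ∑ i, ω i + γ * ∑ j, (a j : ℂ) * y j := by
            congr 1
            rw [Finset.mul_sum]
            exact Finset.sum_congr rfl fun j _ => (e3 j).symm
    rw [Finsupp.prod_pow, ← Complex.exp_add, ← key]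
    simp_rw [e1]
    rw [← Complex.exp_sum]
  unfold subst
  rw [map_sum, expPoly_eq_sum, Finset.mul_sum]
  refine Finset.sum_congr rfl fun a ha => ?_
  rw [MvPolynomial.aeval_monomial, hmono a ha]
  simp only [algebraMap_int_eq, eq_intCast]
  ring

end Summit.Schanuel.Schanuel.Theorems.RootDecomp1EScaleTransfer

end
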